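import Literature.NumberTheory.Automorphic.LanglandsParametersGLUnramifiedProofs
import Literature.NumberTheory.GaloisRepresentations.LocalGaloisGroupFrobeniusProofs
import Mathlib.Analysis.Complex.Basic
import Mathlib.Analysis.Normed.Group.Bounded
import Mathlib.Analysis.SpecificLimits.Basic
import Mathlib.Topology.Algebra.GroupWithZero
import Mathlib.Topology.Instances.Matrix
import HarnessLib

/-!
# Discharge of `isBounded_iff_eigenvalues_norm_one`: an unramified L-parameter of `GL_n` is
# bounded iff its Frobenius eigenvalues lie on the unit circle

D-0014 keeps `Literature/` sorry-free by stating cited results as named facts `def X : Prop`.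
This sibling file of `Literature.NumberTheory.Automorphic.LanglandsParameters` proves its named
fact `isBounded_iff_eigenvalues_norm_one F n` (lang.S14; Borel, Corvallis 1979, §10.3(4), §10.4;
Gross–Reeder 2010, §3.2): an L-parameter `φ` of `LGroupData.gl F n` which is unramified with
Frobenius eigenvalues `α` (`LParameter.IsUnramifiedWith`) is bounded (tempered: the image of
`W_F` in `GL_n(ℂ)` is relatively compact) iff `‖a‖ = 1` for every `a ∈ α`.

The printed argument — "`φ(W_F)` is the cyclic group generated by the semisimple matrix `φ(Frob)`,
which is relatively compact iff its eigenvalues lie on the unit circle" — formalised: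

* (`left_φ_eq_zpow_deg_of_isUnramified`) for unramified `φ` and `w₀` of degree `1`,
  `φ(w).left = φ(w₀).left ^ deg w` for every `w ∈ W_F` (`φ` is the canonical section on inertia,
  the Galois action on `Ĝ` is trivial for `gl`, and `deg` is a homomorphism — the discharged
  `IsFrobPow.mul_holds` / `unique_holds`; a degree-`1` element exists by `exists_isFrobPow_holds`);
  with `φ(w₀) = g diag(d) g⁻¹` (`IsUnramifiedWith`) the image of `W_F` is `{g diag(d)^k g⁻¹ | k ∈ ℤ}`;
* (⇒) on the compact closure the continuous functions `X ↦ (g⁻¹ X g)_{ii}` and `X ↦ det X` are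
  bounded, so `|d_i|^k` (`k ≥ 0`) and `|∏ d_i|^{±k}` are bounded: `|d_i| ≤ 1` for all `i` and
  `∏ |d_i| = 1`, whence `|d_i| = 1`;
* (⇐) if all `|d_i| = 1` the image lies in `g · diagonalGL(𝕋ⁿ) · g⁻¹`, the continuous image of the
  compact torus `𝕋ⁿ = {z ∈ (ℂˣ)ⁿ | |z_i| = 1}`, which is compact, so the closure of the image is
  compact.

## References

* A. Borel, *Automorphic L-functions*, Proc. Sympos. Pure Math. 33 (Corvallis 1979), Part 2,
  §10.3(4), §10.4. [Corvallis1979]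
* B. Gross, M. Reeder, *Arithmetic invariants of discrete Langlands parameters*, Duke Math. J.
  154 (2010), §3.2. [GrossReeder2010]
-/

noncomputable section

open scoped MatrixGroups
open Filter Topology Set

namespace Literature.NumberTheory.Automorphic

namespace LParameter

variable {F : Type*} [Field F] [ValuativeRel F] [TopologicalSpace F] [IsNonarchimedeanLocalField F]
variable {n : ℕ}

/-- `deg (w ^ k) = k * deg w` (the degree is a homomorphism `degHom`, by the discharged facts
`IsFrobPow.mul_holds`, `IsFrobPow.unique_holds`). [folklore] -/
private theorem deg_zpow_gl (w : GaloisRepresentations.WeilGroup F) (k : ℤ) :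
    GaloisRepresentations.WeilGroup.deg (w ^ k) = k * GaloisRepresentations.WeilGroup.deg w := by
  have hmul : GaloisRepresentations.IsFrobPow.mul (F := F) := GaloisRepresentations.IsFrobPow.mul_holds
  have huniq : GaloisRepresentations.IsFrobPow.unique (F := F) :=
    GaloisRepresentations.IsFrobPow.unique_holds
  have h := map_zpow (GaloisRepresentations.WeilGroup.degHom F hmul huniq) w k
  simp only [GaloisRepresentations.WeilGroup.degHom_apply] at h
  have h' := congrArg Multiplicative.toAdd h
  rwa [toAdd_ofAdd, toAdd_zpow, toAdd_ofAdd, smul_eq_mul] at h'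

omit [ValuativeRel F] [TopologicalSpace F] [IsNonarchimedeanLocalField F] in
/-- In `ᴸGL_n = GL_n(ℂ) × Γ_F` (trivial Galois action) the `GL_n(ℂ)`-component is multiplicative.
[folklore] -/
private theorem left_mul_gl (x y : (LGroupData.gl F n).LGroup) : (x * y).left = x.left * y.left := by
  have hga : (LGroupData.gl F n).galAct = 1 := LGroupData.isSplit_gl n
  simp [SemidirectProduct.mul_left, hga]

/-- For `GL_n`, `w ↦ φ(w).left` is a group homomorphism, so `φ(w ^ k).left = φ(w).left ^ k`.
[folklore] -/
private theorem left_φ_zpow (φ : LParameter (LGroupData.gl F n))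
    (w : GaloisRepresentations.WeilGroup F) (k : ℤ) : (φ.φ (w ^ k)).left = (φ.φ w).left ^ k := by
  let L : GaloisRepresentations.WeilGroup F →* (LGroupData.gl F n).dual :=
    { toFun := fun w => (φ.φ w).left
      map_one' := by simp
      map_mul' := fun a b => by
        change (φ.φ (a * b)).left = (φ.φ a).left * (φ.φ b).left
        rw [map_mul, left_mul_gl] }
  exact map_zpow L w k

/-- **The image of `W_F` under an unramified parameter of `GL_n` is cyclic**: for unramified `φ`
and `w₀` of degree `1`, `φ(w).left = φ(w₀).left ^ deg w` for every `w ∈ W_F`.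
Ref: Borel, Corvallis 1979, §§9.5, 10.4. [cite: Corvallis1979, §10.4] -/
theorem left_φ_eq_zpow_deg_of_isUnramified {φ : LParameter (LGroupData.gl F n)}
    (hφ : φ.IsUnramified) {w₀ : GaloisRepresentations.WeilGroup F}
    (hw₀ : GaloisRepresentations.WeilGroup.deg w₀ = 1) (w : GaloisRepresentations.WeilGroup F) :
    (φ.φ w).left = (φ.φ w₀).left ^ GaloisRepresentations.WeilGroup.deg w := by
  have hmul : GaloisRepresentations.IsFrobPow.mul (F := F) := GaloisRepresentations.IsFrobPow.mul_holds
  have huniq : GaloisRepresentations.IsFrobPow.unique (F := F) :=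
    GaloisRepresentations.IsFrobPow.unique_holds
  set k := GaloisRepresentations.WeilGroup.deg w with hk
  have hdeg : GaloisRepresentations.WeilGroup.deg (w₀ ^ k) = k := by
    rw [deg_zpow_gl, hw₀, mul_one]
  have hu : w * (w₀ ^ k)⁻¹ ∈ GaloisRepresentations.WeilGroup.inertia F := by
    rw [← GaloisRepresentations.WeilGroup.deg_eq_zero_iff_mem_inertia hmul huniq,
      GaloisRepresentations.WeilGroup.deg_mul hmul huniq,
      GaloisRepresentations.WeilGroup.deg_inv hmul huniq, hdeg, ← hk]
    ring
  have e : w = w * (w₀ ^ k)⁻¹ * w₀ ^ k := by group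
  conv_lhs => rw [e]
  rw [left_φ_inertia_mul_of_isUnramified hφ hu, left_φ_zpow]

end LParameter

/-! ### Topological lemmas on `GL_n(ℂ)` -/

section GLTop

variable {ι : Type*} [Fintype ι] [DecidableEq ι]

/-- The unit circle of `ℂˣ` is compact (it is the unit sphere of `ℂ` under the embedding
`ℂˣ → ℂ`). [folklore] -/
private theorem isCompact_units_norm_eq_one : IsCompact {u : ℂˣ | ‖(u : ℂ)‖ = 1} := by
  rw [Units.isEmbedding_val₀.isCompact_iff]
  have e : ((↑) : ℂˣ → ℂ) '' {u : ℂˣ | ‖(u : ℂ)‖ = 1} = Metric.sphere (0 : ℂ) 1 := by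
    ext z
    simp only [Set.mem_image, Set.mem_setOf_eq, mem_sphere_iff_norm, sub_zero]
    constructor
    · rintro ⟨u, hu, rfl⟩
      exact hu
    · intro hz
      have hz0 : z ≠ 0 := fun h => by simp [h] at hz
      exact ⟨Units.mk0 z hz0, hz, rfl⟩
  rw [e]
  exact isCompact_sphere 0 1

/-- The diagonal embedding `(ℂˣ)^ι → GL_ι(ℂ)` is continuous. [folklore] -/
private theorem continuous_diagonalGL : Continuous (diagonalGL ι ℂ) := by
  refine Units.continuous_iff.mpr ⟨?_, ?_⟩
  · have e : (Units.val ∘ diagonalGL ι ℂ) = fun z => Matrix.diagonal fun i => ((z i : ℂˣ) : ℂ) := by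
      funext z
      exact coe_diagonalGL z
    rw [e]
    exact (continuous_pi fun i => Units.continuous_val.comp (continuous_apply i)).matrix_diagonal
  · have e : (fun z => (↑(diagonalGL ι ℂ z)⁻¹ : Matrix ι ι ℂ)) =
        fun z => Matrix.diagonal fun i => (((z i)⁻¹ : ℂˣ) : ℂ) := by
      funext z
      rw [← map_inv, coe_diagonalGL]
      rfl
    rw [e]
    exact (continuous_pi fun i =>
      Units.continuous_val.comp ((continuous_apply i).inv)).matrix_diagonal

end GLTop

/-! ### The discharge -/

section Holds

variable {F : Type*} [Field F] [ValuativeRel F] [TopologicalSpace F] [IsNonarchimedeanLocalField F]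

variable (F) in
/-- **Discharge of `isBounded_iff_eigenvalues_norm_one`** (lang.S14): an L-parameter of `GL_n`
unramified with Frobenius eigenvalues `α` is bounded (tempered) iff every `a ∈ α` has `‖a‖ = 1` —
`φ(W_F)` is the cyclic group generated by `φ(Frob) = g diag(d) g⁻¹`
(`LParameter.left_φ_eq_zpow_deg_of_isUnramified`); if its closure is compact, the bounded
continuous functions `X ↦ (g⁻¹ X g)_{ii}` and `det` force `|d_i| ≤ 1` and `∏ |d_i| = 1`, hence
`|d_i| = 1`; conversely it lies in the compact set `g · diagonalGL(𝕋ⁿ) · g⁻¹`.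
Ref: Borel, Corvallis 1979, §10.3(4), §10.4; Gross–Reeder, Duke Math. J. 154 (2010), §3.2.
[cite: Corvallis1979, §10.3(4)] -/
theorem isBounded_iff_eigenvalues_norm_one_holds (n : ℕ) : isBounded_iff_eigenvalues_norm_one F n := by
  intro φ α hα
  classical
  have hmul : GaloisRepresentations.IsFrobPow.mul (F := F) := GaloisRepresentations.IsFrobPow.mul_holds
  have huniq : GaloisRepresentations.IsFrobPow.unique (F := F) :=
    GaloisRepresentations.IsFrobPow.unique_holds
  have hex : GaloisRepresentations.exists_isFrobPow (F := F) := GaloisRepresentations.exists_isFrobPow_holds F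
  obtain ⟨w₀, hw₀⟩ := GaloisRepresentations.WeilGroup.deg_surjective hmul huniq hex 1
  obtain ⟨g, d, hM, hαd⟩ := hα.2 w₀ hw₀
  -- notation-free abbreviations
  set M₀ : GL (Fin (LGroupData.gl F n).rank) ℂ :=
    ((φ.φ w₀).left : GL (Fin (LGroupData.gl F n).rank) ℂ) with hM₀def
  -- the eigenvalues are non-zero
  have hdet : (Matrix.diagonal d).det ≠ 0 := by
    have h := Matrix.GeneralLinearGroup.det_ne_zero M₀
    rw [hM₀def, hM, Matrix.det_units_conj] at h
    exact h
  have hd0 : ∀ i, d i ≠ 0 := by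
    intro i hi
    apply hdet
    rw [Matrix.det_diagonal]
    exact Finset.prod_eq_zero (Finset.mem_univ i) hi
  -- the diagonal unit and `M₀ = g D g⁻¹`
  let du : Fin (LGroupData.gl F n).rank → ℂˣ := fun i => Units.mk0 (d i) (hd0 i)
  have hDu : (diagonalGL _ ℂ du : Matrix (Fin (LGroupData.gl F n).rank) (Fin (LGroupData.gl F n).rank) ℂ) = Matrix.diagonal d := by
    rw [coe_diagonalGL]
    rfl
  have hM₀ : M₀ = g * diagonalGL _ ℂ du * g⁻¹ :=
    Units.ext (by rw [Units.val_mul, Units.val_mul, hDu]; exact hM)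
  -- membership in `α`
  have hmemα : ∀ a ∈ α, ∃ i, d i = a := by
    intro a ha
    rw [← hαd, Multiset.mem_map] at ha
    obtain ⟨i, -, hi⟩ := ha
    exact ⟨i, hi⟩
  have hdmem : ∀ i, d i ∈ α := fun i => by
    rw [← hαd]
    exact Multiset.mem_map_of_mem _ (Finset.mem_univ_val i)
  -- the image of `W_F`: powers of `M₀`
  have hR : ∀ w : GaloisRepresentations.WeilGroup F,
      ((φ.φ w).left : GL (Fin (LGroupData.gl F n).rank) ℂ) = M₀ ^ GaloisRepresentations.WeilGroup.deg w := by
    intro w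
    rw [LParameter.left_φ_eq_zpow_deg_of_isUnramified hα.1 hw₀ w, Subgroup.coe_zpow]
  have hmem : ∀ k : ℤ, M₀ ^ k ∈ closure (Set.range fun w : GaloisRepresentations.WeilGroup F =>
      ((φ.φ w).left : GL (Fin (LGroupData.gl F n).rank) ℂ)) := by
    intro k
    refine subset_closure ⟨w₀ ^ k, ?_⟩
    change ((φ.φ (w₀ ^ k)).left : GL (Fin (LGroupData.gl F n).rank) ℂ) = M₀ ^ k
    rw [hR, LParameter.deg_zpow_gl, hw₀, mul_one]
  constructor
  · -- (⇒) bounded ⇒ eigenvalues on the unit circle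
    intro hb a ha
    obtain ⟨i₀, rfl⟩ := hmemα a ha
    change IsCompact (closure (Set.range fun w : GaloisRepresentations.WeilGroup F =>
      ((φ.φ w).left : GL (Fin (LGroupData.gl F n).rank) ℂ))) at hb
    -- Step 1: `‖d i‖ ≤ 1` for every `i`
    have hle : ∀ i, ‖d i‖ ≤ 1 := by
      intro i
      let f : GL (Fin (LGroupData.gl F n).rank) ℂ → ℂ := fun X => ((g⁻¹ * X * g : GL (Fin (LGroupData.gl F n).rank) ℂ) : Matrix (Fin (LGroupData.gl F n).rank) (Fin (LGroupData.gl F n).rank) ℂ) i i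
      have hf : Continuous f := by
        have h1 : Continuous fun X : GL (Fin (LGroupData.gl F n).rank) ℂ => g⁻¹ * X * g :=
          (continuous_const.mul continuous_id).mul continuous_const
        have h2 : Continuous fun X : GL (Fin (LGroupData.gl F n).rank) ℂ => ((g⁻¹ * X * g : GL (Fin (LGroupData.gl F n).rank) ℂ) : Matrix (Fin (LGroupData.gl F n).rank) (Fin (LGroupData.gl F n).rank) ℂ) :=
          Units.continuous_val.comp h1
        exact (continuous_apply i).comp ((continuous_apply i).comp h2)
      obtain ⟨C, hC⟩ := hb.exists_bound_of_continuousOn hf.continuousOn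
      have hfk : ∀ k : ℕ, f (M₀ ^ (k : ℤ)) = d i ^ k := by
        intro k
        simp only [f, zpow_natCast, hM₀, conj_pow]
        rw [show g⁻¹ * (g * diagonalGL _ ℂ du ^ k * g⁻¹) * g = diagonalGL _ ℂ du ^ k by group,
          Units.val_pow_eq_pow_val, hDu, Matrix.diagonal_pow, Matrix.diagonal_apply_eq, Pi.pow_apply]
      have hbd : ∀ k : ℕ, ‖d i‖ ^ k ≤ C := fun k => by
        rw [← norm_pow, ← hfk k]
        exact hC _ (hmem k)
      rcases le_or_gt ‖d i‖ 1 with h | hgt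
      · exact h
      · exfalso
        obtain ⟨N, hN⟩ := Filter.tendsto_atTop_atTop.mp (tendsto_pow_atTop_atTop_of_one_lt hgt) (C + 1)
        have := hN N le_rfl
        linarith [hbd N]
    -- Step 2: `‖∏ d i‖ = 1` via the determinant
    have hprod : ∏ i, ‖d i‖ = 1 := by
      let fdet : GL (Fin (LGroupData.gl F n).rank) ℂ → ℂ := fun X => (X : Matrix (Fin (LGroupData.gl F n).rank) (Fin (LGroupData.gl F n).rank) ℂ).det
      have hfdet : Continuous fdet := Units.continuous_val.matrix_det
      obtain ⟨C, hC⟩ := hb.exists_bound_of_continuousOn hfdet.continuousOn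
      have hdetM : (M₀ : Matrix (Fin (LGroupData.gl F n).rank) (Fin (LGroupData.gl F n).rank) ℂ).det = ∏ i, d i := by
        rw [hM₀def, hM, Matrix.det_units_conj, Matrix.det_diagonal]
      set z : ℂ := ∏ i, d i with hz
      have hz0 : z ≠ 0 := by
        rw [hz]
        exact Finset.prod_ne_zero_iff.mpr fun i _ => hd0 i
      have hpos : ∀ k : ℕ, ‖z‖ ^ k ≤ C := fun k => by
        have h := hC _ (hmem k)
        simp only [fdet, zpow_natCast, Units.val_pow_eq_pow_val, Matrix.det_pow, hdetM] at h
        rwa [norm_pow] at h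
      have hneg : ∀ k : ℕ, ‖z⁻¹‖ ^ k ≤ C := fun k => by
        have h := hC _ (hmem (-(k : ℤ)))
        simp only [fdet, zpow_neg, zpow_natCast] at h
        rw [Matrix.coe_units_inv, Matrix.det_nonsing_inv, Units.val_pow_eq_pow_val, Matrix.det_pow,
          hdetM, Ring.inverse_eq_inv', ← inv_pow, norm_pow] at h
        exact h
      have h1 : ‖z‖ ≤ 1 := by
        rcases le_or_gt ‖z‖ 1 with h | hgt
        · exact h
        · exfalso
          obtain ⟨N, hN⟩ := Filter.tendsto_atTop_atTop.mp (tendsto_pow_atTop_atTop_of_one_lt hgt) (C + 1)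
          have := hN N le_rfl
          linarith [hpos N]
      have h2 : 1 ≤ ‖z‖ := by
        rcases le_or_gt 1 ‖z‖ with h | hlt
        · exact h
        · exfalso
          have hgt : 1 < ‖z⁻¹‖ := by
            rw [norm_inv]
            exact (one_lt_inv₀ (norm_pos_iff.mpr hz0)).mpr hlt
          obtain ⟨N, hN⟩ := Filter.tendsto_atTop_atTop.mp (tendsto_pow_atTop_atTop_of_one_lt hgt) (C + 1)
          have := hN N le_rfl
          linarith [hneg N]
      rw [← norm_prod, ← hz]
      exact le_antisymm h1 h2
    -- Step 3: conclude `‖d i₀‖ = 1`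
    by_contra hne
    have hlt : ‖d i₀‖ < 1 := lt_of_le_of_ne (hle i₀) hne
    have hrest : ∏ i ∈ Finset.univ.erase i₀, ‖d i‖ ≤ 1 :=
      Finset.prod_le_one (fun i _ => norm_nonneg _) fun i _ => hle i
    have h := Finset.mul_prod_erase Finset.univ (fun i => ‖d i‖) (Finset.mem_univ i₀)
    rw [hprod] at h
    have : ‖d i₀‖ * ∏ i ∈ Finset.univ.erase i₀, ‖d i‖ < 1 :=
      lt_of_le_of_lt (mul_le_of_le_one_right (norm_nonneg _) hrest) hlt
    linarith
  · -- (⇐) eigenvalues on the unit circle ⇒ bounded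
    intro h1
    have hdi : ∀ i, ‖d i‖ = 1 := fun i => h1 (d i) (hdmem i)
    change IsCompact (closure (Set.range fun w : GaloisRepresentations.WeilGroup F =>
      ((φ.φ w).left : GL (Fin (LGroupData.gl F n).rank) ℂ)))
    -- the compact set `g · diagonalGL(𝕋ⁿ) · g⁻¹`
    let T : (Fin (LGroupData.gl F n).rank → ℂˣ) →* GL (Fin (LGroupData.gl F n).rank) ℂ :=
      (MulAut.conj g).toMonoidHom.comp (diagonalGL _ ℂ)
    have hT : Continuous T := by
      change Continuous fun z => g * diagonalGL _ ℂ z * g⁻¹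
      exact (continuous_const.mul continuous_diagonalGL).mul continuous_const
    set S : Set (Fin (LGroupData.gl F n).rank → ℂˣ) :=
      Set.pi Set.univ fun _ => {u : ℂˣ | ‖(u : ℂ)‖ = 1} with hS
    have hSc : IsCompact S := isCompact_univ_pi fun _ => isCompact_units_norm_eq_one
    have hK : IsCompact (T '' S) := hSc.image hT
    refine hK.of_isClosed_subset isClosed_closure (closure_minimal ?_ hK.isClosed)
    rintro _ ⟨w, rfl⟩
    refine ⟨du ^ GaloisRepresentations.WeilGroup.deg w, ?_, ?_⟩
    · simp only [hS, Set.mem_univ_pi, Set.mem_setOf_eq, Pi.pow_apply, Units.val_zpow_eq_zpow_val,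
        norm_zpow]
      intro i
      rw [show ((du i : ℂˣ) : ℂ) = d i from rfl, hdi, one_zpow]
    · change g * diagonalGL _ ℂ (du ^ GaloisRepresentations.WeilGroup.deg w) * g⁻¹ =
        ((φ.φ w).left : GL (Fin (LGroupData.gl F n).rank) ℂ)
      rw [hR w, hM₀, conj_zpow, map_zpow]

end Holds

end Literature.NumberTheory.Automorphic

end
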